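import Literature.AnabelianGeometry.SemiGraphs.SubdivisionLemmas

/-!
# Cusp omissions of semi-graphs: omitting open, non-isolated edges ([SemiAnbd] §1 pp. 11–13; [IUTchI] §2 p. 44)

Mochizuki, *Semi-graphs of anabelioids*, Publ. RIMS **42** (2006) 221–322, §1, author's manuscript
pp. 11–13 [cite: MochizukiSemiAnbd2006, §1 pp.11-13]: closed / open / isolated edges (p. 12) and "the
sub-semi-graph of `G` obtained by omitting all of the open edges", the *maximal subgraph* (p. 13,
`SemiGraph.maximalSubgraph`).  Mochizuki, *Inter-universal Teichmüller theory I*, §2, author's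
manuscript (May 2020) p. 44 [cite: Mochizuki2012, IUTchI §2 p.44] uses it in the form "the restriction
of `ℋ` to the maximal subgraph … up to the possible omission of some of the cuspidal edges … the
omission of cuspidal edges clearly does not affect either the tempered or pro-`Σ̂` fundamental groups".

This file (abc-iut cell, layer L3, row W4-30 part 1a; ADDITIVE, pure semi-graph combinatorics over
`SemiGraph.lean` / `SubdivisionLemmas.lean`) isolates the combinatorial notion behind that sentence:

* `SemiGraph.Subgraph.IsCuspOmission H` — `H` keeps every vertex and every omitted edge has exactly
  ONE abutting branch (a "cuspidal edge": open, not isolated); chosen cusp data `vtx`, `cusp`, …;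
* `SemiGraph.vertCard_le_two`, `existsUnique_abuts_of_vertCard_eq_one`,
  `maximalSubgraph_isCuspOmission` (no isolated edges ⇒ the maximal subgraph is a cusp omission),
  `not_isIsolatedEdge_of_isConnected` (a connected semi-graph with a vertex has no isolated edge);
* `Subgraph.IsCuspOmission.isConnected` / `isConnected_maximalSubgraph`: omitting cusps preserves
  connectedness (each omitted edge is a pendant "hair" of the barycentric subdivision, retracted onto
  its vertex).

The anabelioid side (`B(𝒢)`, `Π_𝒢` unchanged) is `CuspOmission.lean`.
-/

namespace Literature.AnabelianGeometry.SemiGraphs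

universe u

/-! ### Cusp omissions of semi-graphs ([SemiAnbd] §1 pp. 12–13) -/

namespace SemiGraph

variable {G : SemiGraph.{u}}

/-- A sub-semi-graph `H ⊆ G` is a *cusp omission* if it contains every vertex of `G` and every edge
of `G` not in `H` has exactly one branch abutting to a vertex (i.e. is open but not isolated — a
"cuspidal edge"; [SemiAnbd] §1 pp. 12–13, [IUTchI] §2 p. 44 "omission of some of the cuspidal
edges"). [cite: MochizukiSemiAnbd2006, §1 p.13] -/
@[mk_iff] structure Subgraph.IsCuspOmission (H : G.Subgraph) : Prop where
  /-- every vertex is kept -/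
  verts_eq : H.verts = Set.univ
  /-- an omitted edge has exactly one abutting branch -/
  existsUnique_abuts : ∀ e : G.Edge, e ∉ H.edges →
    ∃ b : G.Branch, G.edgeOf b = e ∧ (G.abuts b).isSome = true ∧
      ∀ b' : G.Branch, G.edgeOf b' = e → (G.abuts b').isSome = true → b' = b

/-- The verticial cardinality of an edge is at most `2` (an edge has two branches).
[cite: MochizukiSemiAnbd2006, §1 p.11] -/
theorem vertCard_le_two (e : G.Edge) : G.vertCard e ≤ 2 := by
  obtain ⟨b₁, b₂, hne, -, -, hall⟩ := G.two_branches e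
  have hsub : G.verticialPortion e ⊆ {b₁, b₂} := fun b hb => by
    rcases hall b hb.1 with rfl | rfl <;> simp
  calc G.vertCard e = (G.verticialPortion e).ncard := rfl
    _ ≤ ({b₁, b₂} : Set G.Branch).ncard := Set.ncard_le_ncard hsub (Set.toFinite _)
    _ = 2 := Set.ncard_pair hne

/-- An edge of verticial cardinality `1` has exactly one abutting branch.
[cite: MochizukiSemiAnbd2006, §1 p.12] -/
theorem existsUnique_abuts_of_vertCard_eq_one {e : G.Edge} (he : G.vertCard e = 1) :
    ∃ b : G.Branch, G.edgeOf b = e ∧ (G.abuts b).isSome = true ∧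
      ∀ b' : G.Branch, G.edgeOf b' = e → (G.abuts b').isSome = true → b' = b := by
  obtain ⟨b, hb⟩ := Set.ncard_eq_one.mp he
  have hmem : b ∈ G.verticialPortion e := by rw [hb]; exact Set.mem_singleton b
  refine ⟨b, hmem.1, hmem.2, fun b' hb'e hb's => ?_⟩
  have : b' ∈ G.verticialPortion e := ⟨hb'e, hb's⟩
  rw [hb] at this
  exact this

/-- **The maximal subgraph is a cusp omission** when `G` has no isolated edges (e.g. `G` connected
with at least one vertex): omitting all open edges keeps every vertex, and an open, non-isolated
edge has exactly one abutting branch ([SemiAnbd] §1 p. 13 "the sub-semi-graph of `G` obtained by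
omitting all of the open edges"; [IUTchI] §2 p. 44). [cite: MochizukiSemiAnbd2006, §1 p.13] -/
theorem maximalSubgraph_isCuspOmission (hG : ∀ e : G.Edge, ¬ G.IsIsolatedEdge e) :
    G.maximalSubgraph.IsCuspOmission where
  verts_eq := rfl
  existsUnique_abuts e he := by
    have h2 : G.vertCard e ≠ 2 := he
    have h0 : G.vertCard e ≠ 0 := hG e
    have hle := G.vertCard_le_two e
    exact existsUnique_abuts_of_vertCard_eq_one (by omega)

/-- In a sub-semi-graph, a branch abuts to a vertex of the sub-semi-graph iff it does so in `G`
(conditions (b), (c) of [SemiAnbd] §1 p. 12). [cite: MochizukiSemiAnbd2006, §1 p.12] -/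
theorem Subgraph.abuts_mk_eq_some_iff (H : G.Subgraph) {b : G.Branch} (hb : G.edgeOf b ∈ H.edges)
    (v : H.toSemiGraph.Vertex) :
    H.toSemiGraph.abuts ⟨b, hb⟩ = some v ↔ G.abuts b = some v.1 := by
  constructor
  · intro h
    exact H.ι.abuts_branchMap ⟨b, hb⟩ v h
  · intro h
    classical
    have key : ∀ (o : Option G.Vertex), o = some v.1 →
        (o.pbind fun w _ => if hw : w ∈ H.verts then some ⟨w, hw⟩ else none) = some v := by
      rintro o rfl
      change (if hw : v.1 ∈ H.verts then some ⟨v.1, hw⟩ else none) = some v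
      rw [dif_pos v.2]
      rfl
    exact key (G.abuts b) h

namespace Subgraph.IsCuspOmission

variable {H : G.Subgraph} (hH : H.IsCuspOmission)
include hH

/-- The vertex of the cusp omission `H` lying under a vertex of `G` (every vertex is kept).
[cite: MochizukiSemiAnbd2006, §1 p.13] -/
def vtx (v : G.Vertex) : H.toSemiGraph.Vertex := ⟨v, by rw [hH.verts_eq]; trivial⟩

omit hH in
/-- `vtx` is a section of the inclusion. [cite: MochizukiSemiAnbd2006, §1 p.13] -/
@[simp] theorem vtx_val (hH : H.IsCuspOmission) (v : G.Vertex) : (hH.vtx v).1 = v := rfl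

/-- An omitted edge has an abutting branch together with the vertex it abuts to.
[cite: MochizukiSemiAnbd2006, §1 p.13] -/
theorem exists_cusp (e : G.Edge) (he : e ∉ H.edges) :
    ∃ p : G.Branch × G.Vertex, G.edgeOf p.1 = e ∧ G.abuts p.1 = some p.2 := by
  obtain ⟨b, hbe, hbs, -⟩ := hH.existsUnique_abuts e he
  obtain ⟨v, hv⟩ := Option.isSome_iff_exists.mp hbs
  exact ⟨(b, v), hbe, hv⟩

/-- A CHOSEN abutting branch of an omitted (cuspidal) edge, with its vertex.
[cite: MochizukiSemiAnbd2006, §1 p.13] -/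
noncomputable def cusp (e : G.Edge) (he : e ∉ H.edges) : G.Branch × G.Vertex :=
  (hH.exists_cusp e he).choose

/-- The chosen branch is a branch of the edge. [cite: MochizukiSemiAnbd2006, §1 p.13] -/
theorem edgeOf_cusp (e : G.Edge) (he : e ∉ H.edges) : G.edgeOf (hH.cusp e he).1 = e :=
  (hH.exists_cusp e he).choose_spec.1

/-- The chosen branch abuts to the chosen vertex. [cite: MochizukiSemiAnbd2006, §1 p.13] -/
theorem abuts_cusp (e : G.Edge) (he : e ∉ H.edges) :
    G.abuts (hH.cusp e he).1 = some (hH.cusp e he).2 :=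
  (hH.exists_cusp e he).choose_spec.2

/-- Uniqueness: ANY abutting branch of an omitted edge is the chosen one (and so is its vertex).
[cite: MochizukiSemiAnbd2006, §1 p.13] -/
theorem eq_cusp {e : G.Edge} {he : e ∉ H.edges} {b : G.Branch} {v : G.Vertex}
    (hbe : G.edgeOf b = e) (hv : G.abuts b = some v) :
    b = (hH.cusp e he).1 ∧ v = (hH.cusp e he).2 := by
  obtain ⟨b₀, hb₀, -, huniq⟩ := hH.existsUnique_abuts e he
  have h1 : b = b₀ := huniq b hbe (by rw [hv]; rfl)
  have h2 : (hH.cusp e he).1 = b₀ :=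
    huniq _ (hH.edgeOf_cusp e he) (by rw [hH.abuts_cusp]; rfl)
  refine ⟨h1.trans h2.symm, ?_⟩
  have h3 := hH.abuts_cusp e he
  rw [← h1.trans h2.symm, hv] at h3
  exact Option.some_injective _ h3

end Subgraph.IsCuspOmission

/-! ### Omitting cusps preserves connectedness -/

/-- A map between the vertex sets of two simple graphs that sends adjacent vertices to equal or
adjacent vertices preserves reachability. [folklore] -/
private theorem reachable_map_of_adj_imp {V W : Type*} {G₁ : SimpleGraph V} {G₂ : SimpleGraph W}
    (f : V → W) (hf : ∀ ⦃a b : V⦄, G₁.Adj a b → f a = f b ∨ G₂.Adj (f a) (f b)) {a b : V}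
    (h : G₁.Reachable a b) : G₂.Reachable (f a) (f b) := by
  obtain ⟨p⟩ := h
  induction p with
  | nil => exact SimpleGraph.Reachable.refl _
  | cons hadj _ ih =>
    rcases hf hadj with h | h
    · rw [h]; exact ih
    · exact h.reachable.trans ih

/-- **Omitting cuspidal edges preserves connectedness**: for a cusp omission `H` of a connected
semi-graph `G`, `H` is connected — each omitted edge together with its two branches retracts onto
the vertex its unique abutting branch abuts to, compatibly with the incidence relation of the
barycentric subdivision ([SemiAnbd] §1 pp. 11–13; [IUTchI] §2 p. 44).
[cite: MochizukiSemiAnbd2006, §1 p.13] -/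
theorem Subgraph.IsCuspOmission.isConnected {H : G.Subgraph} (hH : H.IsCuspOmission)
    (hG : G.IsConnected) : H.toSemiGraph.IsConnected := by
  classical
  -- the retraction of the nodes of `G` onto the nodes of `H`
  let π : G.Node → H.toSemiGraph.Node := Sum.elim (fun v => Sum.inl (hH.vtx v))
    (Sum.elim
      (fun e => if he : e ∈ H.edges then Sum.inr (Sum.inl ⟨e, he⟩)
        else Sum.inl (hH.vtx (hH.cusp e he).2))
      (fun b => if he : G.edgeOf b ∈ H.edges then Sum.inr (Sum.inr ⟨b, he⟩)
        else Sum.inl (hH.vtx (hH.cusp (G.edgeOf b) he).2)))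
  -- `π` sends incident nodes to equal or adjacent nodes
  have hrel : ∀ ⦃x y : G.Node⦄, G.NodeRel x y →
      π x = π y ∨ H.toSemiGraph.subdivision.Adj (π x) (π y) := by
    intro x y hxy
    rcases hxy with ⟨b⟩ | ⟨b, v, hb⟩
    · by_cases he : G.edgeOf b ∈ H.edges
      · right
        simp only [π, Sum.elim_inr, Sum.elim_inl, dif_pos he]
        have h1 : H.toSemiGraph.NodeRel (Sum.inr (Sum.inl (H.toSemiGraph.edgeOf ⟨b, he⟩)))
            (Sum.inr (Sum.inr ⟨b, he⟩)) := NodeRel.edge_branch _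
        exact H.toSemiGraph.subdivision_adj_of_nodeRel h1
      · left
        simp only [π, Sum.elim_inr, Sum.elim_inl, dif_neg he]
    · by_cases he : G.edgeOf b ∈ H.edges
      · right
        simp only [π, Sum.elim_inr, Sum.elim_inl, dif_pos he]
        exact H.toSemiGraph.subdivision_adj_of_nodeRel
          (NodeRel.branch_vertex (⟨b, he⟩ : H.toSemiGraph.Branch) (hH.vtx v)
            ((H.abuts_mk_eq_some_iff he (hH.vtx v)).mpr hb))
      · left
        simp only [π, Sum.elim_inr, Sum.elim_inl, dif_neg he]
        rw [(hH.eq_cusp (he := he) rfl hb).2]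
  have hπ : ∀ ⦃x y : G.Node⦄, G.subdivision.Adj x y →
      π x = π y ∨ H.toSemiGraph.subdivision.Adj (π x) (π y) := by
    intro x y hxy
    rcases (G.subdivision_adj_iff).mp hxy with h | h
    · exact hrel h
    · rcases hrel h with h' | h'
      · exact Or.inl h'.symm
      · exact Or.inr h'.symm
  -- `π` is surjective (a retraction of the inclusion)
  have hsurj : ∀ z : H.toSemiGraph.Node, ∃ x : G.Node, π x = z := by
    rintro (⟨v, hv⟩ | ⟨e, he⟩ | ⟨b, hb⟩)
    · exact ⟨Sum.inl v, rfl⟩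
    · exact ⟨Sum.inr (Sum.inl e), by simp only [π, Sum.elim_inr, Sum.elim_inl, dif_pos he]⟩
    · exact ⟨Sum.inr (Sum.inr b), by simp only [π, Sum.elim_inr, dif_pos hb]⟩
  have hconn := hG.connected
  haveI : Nonempty H.toSemiGraph.Node := by
    obtain ⟨x⟩ := hconn.nonempty
    exact ⟨π x⟩
  refine ⟨⟨fun z w => ?_⟩⟩
  obtain ⟨x, rfl⟩ := hsurj z
  obtain ⟨y, rfl⟩ := hsurj w
  exact reachable_map_of_adj_imp π hπ (hconn.preconnected x y)

/-- **A connected semi-graph with at least one vertex has no isolated edge**: an isolated edge,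
together with its two branches, is a union of connected components of the barycentric subdivision
containing no vertex. [cite: MochizukiSemiAnbd2006, §1 p.12] -/
theorem not_isIsolatedEdge_of_isConnected (hG : G.IsConnected) (hV : Nonempty G.Vertex)
    (e : G.Edge) : ¬ G.IsIsolatedEdge e := by
  intro he
  obtain ⟨v⟩ := hV
  -- no branch of `e` abuts
  have hnone : ∀ b : G.Branch, G.edgeOf b = e → G.abuts b = none := by
    intro b hb
    obtain ⟨b₁, b₂, -, -, -, hall⟩ := G.two_branches e
    have hfin : (G.verticialPortion e).Finite :=
      (Set.toFinite ({b₁, b₂} : Set G.Branch)).subset fun x hx => by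
        rcases hall x hx.1 with rfl | rfl <;> simp
    have h0 : G.verticialPortion e = ∅ := (Set.ncard_eq_zero hfin).mp he
    by_contra hne
    have : b ∈ G.verticialPortion e := ⟨hb, Option.ne_none_iff_isSome.mp hne⟩
    rw [h0] at this
    exact this
  -- the set of nodes `{e} ∪ {branches of e}` is closed under adjacency
  let S : Set G.Node := {z | z = Sum.inr (Sum.inl e) ∨ ∃ b, G.edgeOf b = e ∧ z = Sum.inr (Sum.inr b)}
  have hS : ∀ ⦃x y : G.Node⦄, G.subdivision.Adj x y → x ∈ S → y ∈ S := by
    intro x y hxy hx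
    rcases hx with rfl | ⟨b, hbe, rfl⟩
    · obtain ⟨b, hb, rfl⟩ := (G.subdivision_adj_edge_iff e y).mp hxy
      exact Or.inr ⟨b, hb, rfl⟩
    · rcases (G.subdivision_adj_branch_iff b y).mp hxy with rfl | ⟨w, hw, rfl⟩
      · exact Or.inl (by rw [hbe])
      · rw [hnone b hbe] at hw
        cases hw
  have hwalk : ∀ {x y : G.Node} (_ : G.subdivision.Walk x y), x ∈ S → y ∈ S := by
    intro x y p
    induction p with
    | nil => exact id
    | cons hadj _ ih => exact fun hx => ih (hS hadj hx)
  obtain ⟨p⟩ := hG.connected.preconnected (Sum.inr (Sum.inl e)) (Sum.inl v)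
  rcases hwalk p (Or.inl rfl) with h | ⟨b, -, h⟩
  · cases h
  · cases h

/-- For a connected semi-graph with a vertex, the maximal subgraph is a cusp omission.
[cite: MochizukiSemiAnbd2006, §1 p.13] -/
theorem maximalSubgraph_isCuspOmission_of_isConnected (hG : G.IsConnected)
    (hV : Nonempty G.Vertex) : G.maximalSubgraph.IsCuspOmission :=
  maximalSubgraph_isCuspOmission (not_isIsolatedEdge_of_isConnected hG hV)

/-- **The maximal subgraph of a connected semi-graph with a vertex is connected** ([SemiAnbd] §1
p. 13; the case of [IUTchI] §2 p. 44). [cite: MochizukiSemiAnbd2006, §1 p.13] -/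
theorem isConnected_maximalSubgraph (hG : G.IsConnected) (hV : Nonempty G.Vertex) :
    G.maximalSubgraph.toSemiGraph.IsConnected :=
  (maximalSubgraph_isCuspOmission_of_isConnected hG hV).isConnected hG

/-- Every branch of an edge of the maximal subgraph abuts (closed edges have verticial cardinality
`2`). [cite: MochizukiSemiAnbd2006, §1 p.13] -/
theorem isSome_abuts_of_mem_maximalSubgraph {b : G.Branch}
    (hb : G.edgeOf b ∈ G.maximalSubgraph.edges) : (G.abuts b).isSome = true := by
  have he : G.vertCard (G.edgeOf b) = 2 := hb
  obtain ⟨b₁, b₂, hne, -, -, hall⟩ := G.two_branches (G.edgeOf b)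
  have hsub : G.verticialPortion (G.edgeOf b) ⊆ {b₁, b₂} := fun x hx => by
    rcases hall x hx.1 with rfl | rfl <;> simp
  have heq : G.verticialPortion (G.edgeOf b) = {b₁, b₂} :=
    Set.eq_of_subset_of_ncard_le hsub (by rw [Set.ncard_pair hne]; exact he.ge) (Set.toFinite _)
  have hmem : b ∈ G.verticialPortion (G.edgeOf b) := by
    rw [heq]
    rcases hall b rfl with h | h <;> simp [h]
  exact hmem.2

/-- **The maximal subgraph is a graph**: every branch of each of its edges abuts to one of its
vertices. [cite: MochizukiSemiAnbd2006, §1 p.13] -/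
theorem isGraph_maximalSubgraph (G : SemiGraph.{u}) : G.maximalSubgraph.toSemiGraph.IsGraph := by
  refine ⟨fun b => ?_⟩
  obtain ⟨v, hv⟩ := Option.isSome_iff_exists.mp (G.isSome_abuts_of_mem_maximalSubgraph b.2)
  have : G.maximalSubgraph.toSemiGraph.abuts b = some ⟨v, trivial⟩ :=
    (G.maximalSubgraph.abuts_mk_eq_some_iff b.2 ⟨v, trivial⟩).mpr hv
  rw [this]
  rfl

end SemiGraph

end Literature.AnabelianGeometry.SemiGraphs
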